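import Summits.QuantumFields.YangMills.Theorems.LatticeGapOnTrajectory.Negative.ZeroCouplingGap
import Literature.MathematicalPhysics.QuantumFieldTheory.OSDataSpeciesExtension

/-!
# `GapToContinuum` (stmt-QuantumFields-8896) — negative-side support II: `IsYangMillsFor` is
# load-bearing, modulo a gapless one-field OS datum

Support file for the crux `GapToContinuum`
(`∀ G r sch T Δ, 0 < Δ → IsYangMillsFor r sch T → HasLatticeMassGap r sch Δ → T.HasMassGap Δ`), from the
standing disprover's work file `Cruxes/GapToContinuum/Disproof.lean` §3. Pure proof file (no
definitions); tree objects only.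

* `gapToContinuum_false_without_isYangMillsFor_of_gapless`: IF some one-field OS datum on `ℝ⁴` lacks the
  mass gap at some `Δ > 0` (true in mathematics — the free scalar field of mass `0 < m < Δ` — but not
  inhabited in the tree, where free-field existence is the named fact `existsUnique_freeField` and no
  lower clustering bound is held), THEN the crux with the hypothesis `IsYangMillsFor r sch T` dropped is
  FALSE: relabel the datum over `YMSpecies Unit` (every species reads the one field; tree
  `OSData.exists_extendByZero`) and take the trivial gauge group at zero coupling, where
  `HasLatticeMassGap` holds at every rate (tree `hasLatticeMassGap_of_zero_coupling`). So any proof of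
  the crux must use the tie `IsYangMillsFor` between `T` and the lattice — the lattice gap alone says
  nothing about an unrelated `T`. (Companion facts in the work file: at a trivial group the crux holds
  from `IsYangMillsFor` ALONE, and `0 < Δ` is decoration.) [folklore]
-/

noncomputable section

open MeasureTheory Filter Topology
open Literature.MathematicalPhysics.AQFT Literature.MathematicalPhysics.QuantumLattice
open Literature.MathematicalPhysics.QuantumFieldTheory

namespace Summit.QuantumFields.YangMills.Theorems.GapToContinuum.Negative

/-- **`IsYangMillsFor` is load-bearing in `GapToContinuum` (modulo a gapless one-field OS datum).**
[folklore] -/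
theorem gapToContinuum_false_without_isYangMillsFor_of_gapless
    (h : ∃ (T : OSData Unit 4) (Δ : ℝ), 0 < Δ ∧ ¬ T.HasMassGap Δ) :
    ¬ ∀ (G : Type) [Group G] [TopologicalSpace G] [IsTopologicalGroup G] [CompactSpace G]
        [MeasurableSpace G] [BorelSpace G] (r : LatticeRep G) (sch : SpeciesScheme (YMSpecies G))
        (T : OSData (YMSpecies G) 4) (Δ : ℝ), 0 < Δ → HasLatticeMassGap r sch Δ → T.HasMassGap Δ := by
  obtain ⟨T₀, Δ, hΔ, hgap⟩ := h
  intro hcrux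
  -- the trivial representation of the trivial group
  let r : LatticeRep Unit :=
    ⟨1, 1, continuous_const, fun a b _ => Subsingleton.elim a b, fun _ => Submonoid.one_mem _⟩
  -- relabel `T₀` over all species of the trivial group (every species live, reading the one field)
  obtain ⟨T, hlive, -⟩ :=
    OSData.exists_extendByZero (ι := YMSpecies Unit) T₀ (fun _ => ()) (fun _ => True)
  have hT : T.HasMassGap Δ :=
    hcrux Unit r (SpeciesScheme.zero _) T Δ hΔ
      (Summit.QuantumFields.YangMills.Theorems.LatticeGapOnTrajectory.Negative.hasLatticeMassGap_of_zero_coupling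
        r _ (fun _ => rfl) Δ)
  apply hgap
  -- restrict back along one species and identify with `T₀`
  have hres := LabelledSchwingerFamily.HasMassGap.restrict (S := T.schwinger) hT
    (fun _ : Unit => r.curvature)
  have heq : (fun n (k : Fin n → Unit) => T.schwinger n ((fun _ : Unit => r.curvature) ∘ k)) =
      T₀.schwinger := by
    funext n k
    rw [hlive n _ (fun _ => trivial)]
    congr 1
  rw [heq] at hres
  exact hres

end Summit.QuantumFields.YangMills.Theorems.GapToContinuum.Negative

end
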